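import Summits.AtomisticToContinuum.Crystallization.Theorems.HullExactificationCascadeRobustBarlowTemplateTransportSteps1
import Summits.AtomisticToContinuum.Crystallization.Theorems.HullExactificationCascadeRobustBarlowTemplateTransportSteps2
import Summits.AtomisticToContinuum.Crystallization.Theorems.HullExactificationCascadeRobustBarlowTemplateTransportSteps3
import Summits.AtomisticToContinuum.Crystallization.Theorems.HullExactificationCascadeRobustBarlowTemplateTransportSteps5
import Summits.AtomisticToContinuum.Crystallization.Theorems.HullExactificationCascadeRobustBarlowTemplateTransportSteps7
import Summits.AtomisticToContinuum.Crystallization.Theorems.HullExactificationCascadeRobustBarlowTemplateTransportVinv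
import Summits.AtomisticToContinuum.Crystallization.Theorems.HullExactificationCascadeRobustBarlowTemplateTransportComm1
import Summits.AtomisticToContinuum.Crystallization.Theorems.HullExactificationCascadeRobustBarlowTemplateTransportComm3
import Summits.AtomisticToContinuum.Crystallization.Theorems.HullExactificationCascadeRobustBarlowTemplateTransportVComm3

/-!
# Line `registered` (crux `RobustBarlowTemplate`, stmt-AtomisticToContinuum-12088): coherent layers and their `V` / `V⁻¹` images

Helper lemmas for `develop_transport` (the geometric half of the development): frames
`⟨x, t₁, t₂, U⟩` read in the scale-relative integer charts `IsZChart` of an everywhere-good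
configuration, their transports and the coherence of the resulting development `frameAt`.  The
only metric inputs are the chart transfer lemma `develop_transfer` and `bond_nb_iff`; everything
else is label combinatorics in `ℤ³` (pattern facts `TransportPatterns*` of the sibling crux 9227,
imported verbatim).  All `[folklore]` (HalesDSP2012 §1.3 for the two kissing patterns).

PORT of `PalmUnimodularRigidityShellsToBarlowChartTransportGlobalA.lean` of the closed sibling
crux `ShellsToBarlowChart` (stmt-9227) to the SCALE-RELATIVE shell relation `y ∈ shell S x` of
this crux (in place of the bond window `0 < dist x y ∧ dist x y ≤ 28/25`) and to the
five-argument charts `IsZChart S x P A nbr`; the port rules (conjunct paths,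
`bond a b ↦ b ∈ shell S a`, the threaded symmetry hypothesis
`hsy : ∀ x ∈ S, ∀ y ∈ shell S x, x ∈ shell S y` replacing `bond_symm`, `zchart_transfer` /
`zchart_sqNormInt_eq` replacing `sqNormInt_transfer` / `IsZChart.sqNormInt_eq`, the
`open … hiding …` line) are listed under "Port notes" in `…RobustBarlowTemplateTransportSteps1.lean`
(and its extensions in `…TransportSteps6.lean`, `…TransportAttach1.lean`, `…TransportComm3.lean`,
`…TransportVComm3.lean`).

## Port notes (this part: `TransportGlobalA`)
* the signatures of `back_I`, `back_J`, `nbhd`, `layer_up`, `layer_down` are parallel to the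
  source with `hsy` inserted right after `hch` (their proofs call `Istep_spec`, `Jstep_spec`,
  `IinvStep_Istep`, `JinvStep_Jstep`, `Vstep_spec`, `VinvStep_spec`, `Vstep_Istep_comm`,
  `Vstep_Jstep_comm`, `VinvStep_Istep_comm`, `VinvStep_Jstep_comm`, which need symmetry, and
  `back_I`, `back_J`, `nbhd` of this part); no bond and no metric constant occurs in this part,
  so the proofs are the source proofs verbatim up to the `hsy` threading;
* all five lemmas of the source part are chart-dependent, so nothing of the 9227 `GlobalA` is
  reused and that module is NOT imported; the chart-agnostic helpers `hregI_of_valid`,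
  `hregJ_of_valid` are those of the 9227 `Comm1` (visible through our `…TransportComm1`);
* imports: our parts 1, 2, 3, 5, 7, `Vinv`, `Comm1`, `Comm3`, `VComm3` (as in the source), i.e.
  BOTH the `Comm` chain and the `VComm` chain of this crux, each of which imports 9227 modules
  for chart-agnostic lemmas (the same 9227 declaration arriving through two routes is harmless);
  the `open … hiding …` line is the one of our `…TransportVComm3` (it contains the one of our
  `…TransportComm3`: every chart-dependent 9227 name visible here that a part of this crux
  redeclares) — copy it into later parts that import this one;
* the anchor at the end (explicit-`∀` form of `layer_up`, registered sub-goal) is new.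
-/

noncomputable section

namespace Summit.AtomisticToContinuum.Crystallization.Theorems.HullExactificationCascadeRobustBarlowTemplate

open Literature.Geometry.DiscreteGeometry Literature.MathematicalPhysics.StatisticalMechanics
open Summit.AtomisticToContinuum.Crystallization.Theorems.PalmUnimodularRigidityShellsToBarlowChart hiding
  IsZChart TransportSystem scales_tied sqNormInt_transfer bond_symm nb_mem zlab_spec zlab_nb bond_nb_iff
  pattern_cases transfer_nb_nb transfer_nb_centre transfer_nb_target sqNormInt_zlab_centre hcp_of_mirror_pair
  Istep_spec Jstep_spec IinvStep_spec JinvStep_spec capWithAny_of_mem_cap IinvStep_Istep Istep_IinvStep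
  JinvStep_Jstep Jstep_JinvStep polar_at_apex onesided_at_apex nb_inj Istep_lower Jstep_lower
  IinvStep_lower JinvStep_lower Vstep_spec polar_at_lower_apex onesided_at_lower_apex VinvStep_spec
  attach_I_even attach_I_odd attach_lower_I_pos attach_lower_I_neg attach_J_even attach_J_odd
  Vstep_Istep_pt Vstep_Istep_back Vstep_Istep_side Vstep_Jstep_pt Vstep_Istep_comm Vstep_Jstep_comm
  attach_lower_J_pos attach_lower_J_neg VinvStep_Istep_pt VinvStep_Jstep_pt VinvStep_Istep_back
  VinvStep_Istep_side

variable {S : Set (EuclideanSpace ℝ (Fin 3))} {Pc : (EuclideanSpace ℝ (Fin 3)) → Finset (Fin 3 → ℤ)}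
  {Ac : (EuclideanSpace ℝ (Fin 3)) → ((EuclideanSpace ℝ (Fin 3)) →ₗᵢ[ℝ] (EuclideanSpace ℝ (Fin 3)))} {nb : (EuclideanSpace ℝ (Fin 3)) → (Fin 3 → ℤ) → (EuclideanSpace ℝ (Fin 3))}

/-- Going back along `I`: if `⟨x, t₁, t₂, U⟩ = I g'` for a valid `g' = ⟨x', a, b, W⟩` then
`I⁻¹ ⟨x, t₁, t₂, U⟩ = g'`, `nb x (−t₁) = x'`, and the I-regime holds at `g'`. [folklore] -/
theorem back_I (hch : ∀ z ∈ S, IsZChart S z (Pc z) (Ac z) (nb z))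
    (hsy : ∀ x ∈ S, ∀ y ∈ shell S x, x ∈ shell S y) {x x' : (EuclideanSpace ℝ (Fin 3))} {t₁ t₂ a b : Fin 3 → ℤ} {U W : Finset (Fin 3 → ℤ)} (hx' : x' ∈ S) (hW : IsFrame (Pc x') a b W) (hU : IsFrame (Pc x) t₁ t₂ U) (hrel : (⟨x, t₁, t₂, U⟩ : ZFrame) = Istep Pc nb ⟨x', a, b, W⟩) : IinvStep Pc nb ⟨x, t₁, t₂, U⟩ = ⟨x', a, b, W⟩ ∧ nb x (-t₁) = x' ∧ IsFrame (Pc (nb x' a)) (Istep Pc nb ⟨x', a, b, W⟩).t₁ (Istep Pc nb ⟨x', a, b, W⟩).t₂ (Istep Pc nb ⟨x', a, b, W⟩).U := by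
  have hxe : x = (Istep Pc nb ⟨x', a, b, W⟩).pt := congrArg ZFrame.pt hrel
  have ht₁e : t₁ = (Istep Pc nb ⟨x', a, b, W⟩).t₁ := congrArg ZFrame.t₁ hrel
  have ht₂e : t₂ = (Istep Pc nb ⟨x', a, b, W⟩).t₂ := congrArg ZFrame.t₂ hrel
  have hUe : U = (Istep Pc nb ⟨x', a, b, W⟩).U := congrArg ZFrame.U hrel
  have hval : IsFrame (Pc (nb x' a)) (Istep Pc nb ⟨x', a, b, W⟩).t₁ (Istep Pc nb ⟨x', a, b, W⟩).t₂
      (Istep Pc nb ⟨x', a, b, W⟩).U := by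
    rw [hxe, ht₁e, ht₂e, hUe] at hU; exact hU
  have hreg := hregI_of_valid (Pc := Pc) (nb := nb) hval
  obtain ⟨-, -, -, hwx, -⟩ := Istep_spec hch hsy hx' hW hreg
  have hback : nb x (-t₁) = x' := by
    rw [hxe, ht₁e]
    show nb (nb x' a) (-(-zlab Pc nb (nb x' a) x')) = x'
    rw [neg_neg]; exact hwx
  refine ⟨?_, hback, hval⟩
  rw [hrel]; exact IinvStep_Istep hch hsy hx' hW hreg

/-- Going back along `J` (symmetric to `back_I`). [folklore] -/
theorem back_J (hch : ∀ z ∈ S, IsZChart S z (Pc z) (Ac z) (nb z))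
    (hsy : ∀ x ∈ S, ∀ y ∈ shell S x, x ∈ shell S y) {x x' : (EuclideanSpace ℝ (Fin 3))}
    {t₁ t₂ a b : Fin 3 → ℤ} {U W : Finset (Fin 3 → ℤ)} (hx' : x' ∈ S) (hW : IsFrame (Pc x') a b W)
    (hU : IsFrame (Pc x) t₁ t₂ U) (hrel : (⟨x, t₁, t₂, U⟩ : ZFrame) = Jstep Pc nb ⟨x', a, b, W⟩) :
    JinvStep Pc nb ⟨x, t₁, t₂, U⟩ = ⟨x', a, b, W⟩ ∧ nb x (-t₂) = x' ∧
      IsFrame (Pc (nb x' b)) (Jstep Pc nb ⟨x', a, b, W⟩).t₁ (Jstep Pc nb ⟨x', a, b, W⟩).t₂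
        (Jstep Pc nb ⟨x', a, b, W⟩).U := by
  have hxe : x = (Jstep Pc nb ⟨x', a, b, W⟩).pt := congrArg ZFrame.pt hrel
  have ht₁e : t₁ = (Jstep Pc nb ⟨x', a, b, W⟩).t₁ := congrArg ZFrame.t₁ hrel
  have ht₂e : t₂ = (Jstep Pc nb ⟨x', a, b, W⟩).t₂ := congrArg ZFrame.t₂ hrel
  have hUe : U = (Jstep Pc nb ⟨x', a, b, W⟩).U := congrArg ZFrame.U hrel
  have hval : IsFrame (Pc (nb x' b)) (Jstep Pc nb ⟨x', a, b, W⟩).t₁ (Jstep Pc nb ⟨x', a, b, W⟩).t₂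
      (Jstep Pc nb ⟨x', a, b, W⟩).U := by
    rw [hxe, ht₁e, ht₂e, hUe] at hU; exact hU
  have hreg := hregJ_of_valid (Pc := Pc) (nb := nb) hval
  obtain ⟨-, -, -, hwx, -⟩ := Jstep_spec hch hsy hx' hW hreg
  have hback : nb x (-t₂) = x' := by
    rw [hxe, ht₂e]
    show nb (nb x' b) (-(-zlab Pc nb (nb x' b) x')) = x'
    rw [neg_neg]; exact hwx
  refine ⟨?_, hback, hval⟩
  rw [hrel]; exact JinvStep_Jstep hch hsy hx' hW hreg

/-- **The neighbourhood of a site of a coherent layer.**  In a family `Φ : ℤ² → frames` that is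
valid everywhere and coherent (`Φ (i+1) j = I (Φ i j)`, `Φ i (j+1) = J (Φ i j)`), every frame
`⟨x, t₁, t₂, U⟩ = Φ i j` has all the hypotheses of the commutation theorems: the eight frames
around it are valid and the in-layer commutation holds. [folklore] -/
theorem nbhd (hch : ∀ z ∈ S, IsZChart S z (Pc z) (Ac z) (nb z))
    (hsy : ∀ x ∈ S, ∀ y ∈ shell S x, x ∈ shell S y) {Φ : ℤ → ℤ → ZFrame}
    (hval : ∀ i j, IsFrame (Pc (Φ i j).pt) (Φ i j).t₁ (Φ i j).t₂ (Φ i j).U)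
    (hS : ∀ i j, (Φ i j).pt ∈ S) (hI : ∀ i j, Φ (i + 1) j = Istep Pc nb (Φ i j))
    (hJ : ∀ i j, Φ i (j + 1) = Jstep Pc nb (Φ i j)) (i j : ℤ) {x : (EuclideanSpace ℝ (Fin 3))} {t₁ t₂ : Fin 3 → ℤ}
    {U : Finset (Fin 3 → ℤ)} (h : Φ i j = ⟨x, t₁, t₂, U⟩) :
    x ∈ S ∧ IsFrame (Pc x) t₁ t₂ U ∧
    IsFrame (Pc (nb x t₁)) (Istep Pc nb ⟨x, t₁, t₂, U⟩).t₁ (Istep Pc nb ⟨x, t₁, t₂, U⟩).t₂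
      (Istep Pc nb ⟨x, t₁, t₂, U⟩).U ∧
    IsFrame (Pc (nb x t₂)) (Jstep Pc nb ⟨x, t₁, t₂, U⟩).t₁ (Jstep Pc nb ⟨x, t₁, t₂, U⟩).t₂
      (Jstep Pc nb ⟨x, t₁, t₂, U⟩).U ∧
    IsFrame (Pc (nb x (-t₁))) (IinvStep Pc nb ⟨x, t₁, t₂, U⟩).t₁
      (IinvStep Pc nb ⟨x, t₁, t₂, U⟩).t₂ (IinvStep Pc nb ⟨x, t₁, t₂, U⟩).U ∧
    IsFrame (Pc (nb x (-t₂))) (JinvStep Pc nb ⟨x, t₁, t₂, U⟩).t₁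
      (JinvStep Pc nb ⟨x, t₁, t₂, U⟩).t₂ (JinvStep Pc nb ⟨x, t₁, t₂, U⟩).U ∧
    IsFrame (Pc (nb (nb x t₁) (Istep Pc nb ⟨x, t₁, t₂, U⟩).t₁))
      (Istep Pc nb (Istep Pc nb ⟨x, t₁, t₂, U⟩)).t₁ (Istep Pc nb (Istep Pc nb ⟨x, t₁, t₂, U⟩)).t₂
      (Istep Pc nb (Istep Pc nb ⟨x, t₁, t₂, U⟩)).U ∧
    IsFrame (Pc (nb (nb x t₁) (Istep Pc nb ⟨x, t₁, t₂, U⟩).t₂))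
      (Jstep Pc nb (Istep Pc nb ⟨x, t₁, t₂, U⟩)).t₁ (Jstep Pc nb (Istep Pc nb ⟨x, t₁, t₂, U⟩)).t₂
      (Jstep Pc nb (Istep Pc nb ⟨x, t₁, t₂, U⟩)).U ∧
    IsFrame (Pc (nb (nb x t₁) (-(Istep Pc nb ⟨x, t₁, t₂, U⟩).t₁)))
      (IinvStep Pc nb (Istep Pc nb ⟨x, t₁, t₂, U⟩)).t₁ (IinvStep Pc nb (Istep Pc nb ⟨x, t₁, t₂, U⟩)).t₂
      (IinvStep Pc nb (Istep Pc nb ⟨x, t₁, t₂, U⟩)).U ∧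
    IsFrame (Pc (nb (nb x t₁) (-(Istep Pc nb ⟨x, t₁, t₂, U⟩).t₂)))
      (JinvStep Pc nb (Istep Pc nb ⟨x, t₁, t₂, U⟩)).t₁ (JinvStep Pc nb (Istep Pc nb ⟨x, t₁, t₂, U⟩)).t₂
      (JinvStep Pc nb (Istep Pc nb ⟨x, t₁, t₂, U⟩)).U ∧
    IsFrame (Pc (nb (nb x t₂) (Jstep Pc nb ⟨x, t₁, t₂, U⟩).t₂))
      (Jstep Pc nb (Jstep Pc nb ⟨x, t₁, t₂, U⟩)).t₁ (Jstep Pc nb (Jstep Pc nb ⟨x, t₁, t₂, U⟩)).t₂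
      (Jstep Pc nb (Jstep Pc nb ⟨x, t₁, t₂, U⟩)).U ∧
    IsFrame (Pc (nb (nb x t₂) (Jstep Pc nb ⟨x, t₁, t₂, U⟩).t₁))
      (Istep Pc nb (Jstep Pc nb ⟨x, t₁, t₂, U⟩)).t₁ (Istep Pc nb (Jstep Pc nb ⟨x, t₁, t₂, U⟩)).t₂
      (Istep Pc nb (Jstep Pc nb ⟨x, t₁, t₂, U⟩)).U ∧
    IsFrame (Pc (nb (nb x t₂) (-(Jstep Pc nb ⟨x, t₁, t₂, U⟩).t₂)))
      (JinvStep Pc nb (Jstep Pc nb ⟨x, t₁, t₂, U⟩)).t₁ (JinvStep Pc nb (Jstep Pc nb ⟨x, t₁, t₂, U⟩)).t₂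
      (JinvStep Pc nb (Jstep Pc nb ⟨x, t₁, t₂, U⟩)).U ∧
    IsFrame (Pc (nb (nb x t₂) (-(Jstep Pc nb ⟨x, t₁, t₂, U⟩).t₁)))
      (IinvStep Pc nb (Jstep Pc nb ⟨x, t₁, t₂, U⟩)).t₁ (IinvStep Pc nb (Jstep Pc nb ⟨x, t₁, t₂, U⟩)).t₂
      (IinvStep Pc nb (Jstep Pc nb ⟨x, t₁, t₂, U⟩)).U ∧
    Istep Pc nb (Jstep Pc nb ⟨x, t₁, t₂, U⟩) = Jstep Pc nb (Istep Pc nb ⟨x, t₁, t₂, U⟩) := by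
  -- validity of any `Φ i' j'` written as an explicit expression
  have hvalE : ∀ (i' j' : ℤ) (E : ZFrame), Φ i' j' = E → IsFrame (Pc E.pt) E.t₁ E.t₂ E.U := by
    intro i' j' E hE; rw [← hE]; exact hval i' j'
  have hx : x ∈ S := by have := hS i j; rw [h] at this; exact this
  have hU : IsFrame (Pc x) t₁ t₂ U := hvalE i j _ h
  -- forward expressions
  have eI : Φ (i + 1) j = Istep Pc nb ⟨x, t₁, t₂, U⟩ := by rw [hI, h]
  have eJ : Φ i (j + 1) = Jstep Pc nb ⟨x, t₁, t₂, U⟩ := by rw [hJ, h]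
  have eII : Φ (i + 1 + 1) j = Istep Pc nb (Istep Pc nb ⟨x, t₁, t₂, U⟩) := by rw [hI, eI]
  have eJI : Φ (i + 1) (j + 1) = Jstep Pc nb (Istep Pc nb ⟨x, t₁, t₂, U⟩) := by rw [hJ, eI]
  have eJJ : Φ i (j + 1 + 1) = Jstep Pc nb (Jstep Pc nb ⟨x, t₁, t₂, U⟩) := by rw [hJ, eJ]
  have eIJ : Φ (i + 1) (j + 1) = Istep Pc nb (Jstep Pc nb ⟨x, t₁, t₂, U⟩) := by rw [hI, eJ]
  have hcomm : Istep Pc nb (Jstep Pc nb ⟨x, t₁, t₂, U⟩) = Jstep Pc nb (Istep Pc nb ⟨x, t₁, t₂, U⟩) := by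
    rw [← eIJ, ← eJI]
  have hIg := hvalE _ _ _ eI
  have hJg := hvalE _ _ _ eJ
  have hIIg := hvalE _ _ _ eII
  have hJIg := hvalE _ _ _ eJI
  have hJJg := hvalE _ _ _ eJJ
  have hIJg := hvalE _ _ _ eIJ
  -- backward along I at `(i, j)`: `Φ (i−1) j`
  rcases hm : Φ (i - 1) j with ⟨x', a, b, W⟩
  have hx' : x' ∈ S := by have := hS (i - 1) j; rw [hm] at this; exact this
  have hW : IsFrame (Pc x') a b W := hvalE _ _ _ hm
  have hrelI : (⟨x, t₁, t₂, U⟩ : ZFrame) = Istep Pc nb ⟨x', a, b, W⟩ := by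
    rw [← h, ← hm, ← hI, Int.sub_add_cancel]
  obtain ⟨hIinv, hbackI, -⟩ := back_I hch hsy hx' hW hU hrelI
  -- backward along J at `(i, j)`: `Φ i (j−1)`
  rcases hn : Φ i (j - 1) with ⟨x'', a', b', W'⟩
  have hx'' : x'' ∈ S := by have := hS i (j - 1); rw [hn] at this; exact this
  have hW' : IsFrame (Pc x'') a' b' W' := hvalE _ _ _ hn
  have hrelJ : (⟨x, t₁, t₂, U⟩ : ZFrame) = Jstep Pc nb ⟨x'', a', b', W'⟩ := by
    rw [← h, ← hn, ← hJ, Int.sub_add_cancel]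
  obtain ⟨hJinv, hbackJ, -⟩ := back_J hch hsy hx'' hW' hU hrelJ
  have hIig : IsFrame (Pc (nb x (-t₁))) (IinvStep Pc nb ⟨x, t₁, t₂, U⟩).t₁
      (IinvStep Pc nb ⟨x, t₁, t₂, U⟩).t₂ (IinvStep Pc nb ⟨x, t₁, t₂, U⟩).U := by
    rw [hIinv, hbackI]; exact hW
  have hJig : IsFrame (Pc (nb x (-t₂))) (JinvStep Pc nb ⟨x, t₁, t₂, U⟩).t₁
      (JinvStep Pc nb ⟨x, t₁, t₂, U⟩).t₂ (JinvStep Pc nb ⟨x, t₁, t₂, U⟩).U := by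
    rw [hJinv, hbackJ]; exact hW'
  -- `I⁻¹ (I g) = g`, `J⁻¹ (J g) = g`
  have hregI := hregI_of_valid (Pc := Pc) (nb := nb) hIg
  have hregJ := hregJ_of_valid (Pc := Pc) (nb := nb) hJg
  obtain ⟨hyS, -, -, hwx, -⟩ := Istep_spec hch hsy hx hU hregI
  obtain ⟨hyJS, -, -, hwxJ, -⟩ := Jstep_spec hch hsy hx hU hregJ
  have hIiIg : IsFrame (Pc (nb (nb x t₁) (-(Istep Pc nb ⟨x, t₁, t₂, U⟩).t₁)))
      (IinvStep Pc nb (Istep Pc nb ⟨x, t₁, t₂, U⟩)).t₁ (IinvStep Pc nb (Istep Pc nb ⟨x, t₁, t₂, U⟩)).t₂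
      (IinvStep Pc nb (Istep Pc nb ⟨x, t₁, t₂, U⟩)).U := by
    rw [IinvStep_Istep hch hsy hx hU hregI]
    have e : nb (nb x t₁) (-(Istep Pc nb ⟨x, t₁, t₂, U⟩).t₁) = x := by
      show nb (nb x t₁) (-(-zlab Pc nb (nb x t₁) x)) = x
      rw [neg_neg]; exact hwx
    rw [e]; exact hU
  have hJiJg : IsFrame (Pc (nb (nb x t₂) (-(Jstep Pc nb ⟨x, t₁, t₂, U⟩).t₂)))
      (JinvStep Pc nb (Jstep Pc nb ⟨x, t₁, t₂, U⟩)).t₁ (JinvStep Pc nb (Jstep Pc nb ⟨x, t₁, t₂, U⟩)).t₂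
      (JinvStep Pc nb (Jstep Pc nb ⟨x, t₁, t₂, U⟩)).U := by
    rw [JinvStep_Jstep hch hsy hx hU hregJ]
    have e : nb (nb x t₂) (-(Jstep Pc nb ⟨x, t₁, t₂, U⟩).t₂) = x := by
      show nb (nb x t₂) (-(-zlab Pc nb (nb x t₂) x)) = x
      rw [neg_neg]; exact hwxJ
    rw [e]; exact hU
  -- `J⁻¹ (I g) = Φ (i+1) (j−1)` and `I⁻¹ (J g) = Φ (i−1) (j+1)`
  rcases hp : Φ (i + 1) (j - 1) with ⟨xp, ap, bp, Wp⟩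
  have hxp : xp ∈ S := by have := hS (i + 1) (j - 1); rw [hp] at this; exact this
  have hWp : IsFrame (Pc xp) ap bp Wp := hvalE _ _ _ hp
  rcases hq : Istep Pc nb ⟨x, t₁, t₂, U⟩ with ⟨xq, aq, bq, Wq⟩
  have hrelp : (⟨xq, aq, bq, Wq⟩ : ZFrame) = Jstep Pc nb ⟨xp, ap, bp, Wp⟩ := by
    rw [← hq, ← eI, ← hp, ← hJ, Int.sub_add_cancel]
  have hUq : IsFrame (Pc xq) aq bq Wq := by
    have := hIg; rw [hq] at this; exact this
  obtain ⟨hJinvq, hbackq, -⟩ := back_J hch hsy hxp hWp hUq hrelp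
  have hJiIg : IsFrame (Pc (nb (nb x t₁) (-(Istep Pc nb ⟨x, t₁, t₂, U⟩).t₂)))
      (JinvStep Pc nb (Istep Pc nb ⟨x, t₁, t₂, U⟩)).t₁ (JinvStep Pc nb (Istep Pc nb ⟨x, t₁, t₂, U⟩)).t₂
      (JinvStep Pc nb (Istep Pc nb ⟨x, t₁, t₂, U⟩)).U := by
    have ex : nb x t₁ = xq := congrArg ZFrame.pt hq
    rw [hq, ex, hJinvq]
    show IsFrame (Pc (nb xq (-bq))) ap bp Wp
    rw [hbackq]; exact hWp
  rcases hr : Φ (i - 1) (j + 1) with ⟨xr, ar, br, Wr⟩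
  have hxr : xr ∈ S := by have := hS (i - 1) (j + 1); rw [hr] at this; exact this
  have hWr : IsFrame (Pc xr) ar br Wr := hvalE _ _ _ hr
  rcases hs : Jstep Pc nb ⟨x, t₁, t₂, U⟩ with ⟨xs, as, bs, Ws⟩
  have hrels : (⟨xs, as, bs, Ws⟩ : ZFrame) = Istep Pc nb ⟨xr, ar, br, Wr⟩ := by
    rw [← hs, ← eJ, ← hr, ← hI, Int.sub_add_cancel]
  have hUs : IsFrame (Pc xs) as bs Ws := by
    have := hJg; rw [hs] at this; exact this
  obtain ⟨hIinvs, hbacks, -⟩ := back_I hch hsy hxr hWr hUs hrels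
  have hIiJg : IsFrame (Pc (nb (nb x t₂) (-(Jstep Pc nb ⟨x, t₁, t₂, U⟩).t₁)))
      (IinvStep Pc nb (Jstep Pc nb ⟨x, t₁, t₂, U⟩)).t₁ (IinvStep Pc nb (Jstep Pc nb ⟨x, t₁, t₂, U⟩)).t₂
      (IinvStep Pc nb (Jstep Pc nb ⟨x, t₁, t₂, U⟩)).U := by
    have ex : nb x t₂ = xs := congrArg ZFrame.pt hs
    rw [hs, ex, hIinvs]
    show IsFrame (Pc (nb xs (-as))) ar br Wr
    rw [hbacks]; exact hWr
  rw [hq] at hIIg hJIg hIiIg hJiIg hIg hcomm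
  rw [hs] at hJJg hIJg hJiJg hIiJg hJg hcomm
  have ex : nb x t₁ = xq := congrArg ZFrame.pt hq
  have es : nb x t₂ = xs := congrArg ZFrame.pt hs
  rw [ex] at hIiIg hJiIg ⊢
  rw [es] at hJiJg hIiJg ⊢
  exact ⟨hx, hU, hIg, hJg, hIig, hJig, hIIg, hJIg, hIiIg, hJiIg, hJJg, hIJg, hJiJg, hIiJg, hcomm⟩

/-- **The layer above a coherent layer is coherent** (`V`-images), and the letter read below
the new layer is the parity of the old one. [folklore] -/
theorem layer_up (hch : ∀ z ∈ S, IsZChart S z (Pc z) (Ac z) (nb z))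
    (hsy : ∀ x ∈ S, ∀ y ∈ shell S x, x ∈ shell S y) {Φ : ℤ → ℤ → ZFrame}
    (hval : ∀ i j, IsFrame (Pc (Φ i j).pt) (Φ i j).t₁ (Φ i j).t₂ (Φ i j).U)
    (hS : ∀ i j, (Φ i j).pt ∈ S) (hI : ∀ i j, Φ (i + 1) j = Istep Pc nb (Φ i j))
    (hJ : ∀ i j, Φ i (j + 1) = Jstep Pc nb (Φ i j)) :
    (∀ i j, IsFrame (Pc (Vstep Pc nb (Φ i j)).pt) (Vstep Pc nb (Φ i j)).t₁ (Vstep Pc nb (Φ i j)).t₂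
      (Vstep Pc nb (Φ i j)).U) ∧
    (∀ i j, (Vstep Pc nb (Φ i j)).pt ∈ S) ∧
    (∀ i j, Vstep Pc nb (Φ (i + 1) j) = Istep Pc nb (Vstep Pc nb (Φ i j))) ∧
    (∀ i j, Vstep Pc nb (Φ i (j + 1)) = Jstep Pc nb (Vstep Pc nb (Φ i j))) ∧
    (∀ i j, lowerParity (Vstep Pc nb (Φ i j)).t₁ (Vstep Pc nb (Φ i j)).t₂
        (lowerCap (Pc (Vstep Pc nb (Φ i j)).pt) (Vstep Pc nb (Φ i j)).t₁ (Vstep Pc nb (Φ i j)).t₂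
          (Vstep Pc nb (Φ i j)).U) = frameParity (Φ i j).t₁ (Φ i j).t₂ (Φ i j).U) := by
  refine ⟨fun i j => ?_, fun i j => ?_, fun i j => ?_, fun i j => ?_, fun i j => ?_⟩
  all_goals
    rcases h : Φ i j with ⟨x, t₁, t₂, U⟩
    obtain ⟨hx, hU, hIg, hJg, hIig, hJig, hIIg, hJIg, hIiIg, hJiIg, hJJg, hIJg, hJiJg, hIiJg, hcomm⟩ :=
      nbhd hch hsy hval hS hI hJ i j h
  · exact (Vstep_spec hch hsy hx hU hIg hJg hIig hJig).2.2.2.2.2.1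
  · exact (Vstep_spec hch hsy hx hU hIg hJg hIig hJig).2.1
  · rw [hI, h]; exact Vstep_Istep_comm hch hsy hx hU hIg hJg hIig hJig hIIg hJIg hIiIg hJiIg hcomm
  · rw [hJ, h]; exact Vstep_Jstep_comm hch hsy hx hU hIg hJg hIig hJig hJJg hIJg hJiJg hIiJg hcomm
  · exact (Vstep_spec hch hsy hx hU hIg hJg hIig hJig).2.2.2.2.2.2.1

/-- **The layer below a coherent layer is coherent** (`V⁻¹`-images), and the parity of the new
layer is the letter read below the old one. [folklore] -/
theorem layer_down (hch : ∀ z ∈ S, IsZChart S z (Pc z) (Ac z) (nb z))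
    (hsy : ∀ x ∈ S, ∀ y ∈ shell S x, x ∈ shell S y) {Φ : ℤ → ℤ → ZFrame}
    (hval : ∀ i j, IsFrame (Pc (Φ i j).pt) (Φ i j).t₁ (Φ i j).t₂ (Φ i j).U)
    (hS : ∀ i j, (Φ i j).pt ∈ S) (hI : ∀ i j, Φ (i + 1) j = Istep Pc nb (Φ i j))
    (hJ : ∀ i j, Φ i (j + 1) = Jstep Pc nb (Φ i j)) :
    (∀ i j, IsFrame (Pc (VinvStep Pc nb (Φ i j)).pt) (VinvStep Pc nb (Φ i j)).t₁
      (VinvStep Pc nb (Φ i j)).t₂ (VinvStep Pc nb (Φ i j)).U) ∧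
    (∀ i j, (VinvStep Pc nb (Φ i j)).pt ∈ S) ∧
    (∀ i j, VinvStep Pc nb (Φ (i + 1) j) = Istep Pc nb (VinvStep Pc nb (Φ i j))) ∧
    (∀ i j, VinvStep Pc nb (Φ i (j + 1)) = Jstep Pc nb (VinvStep Pc nb (Φ i j))) ∧
    (∀ i j, frameParity (VinvStep Pc nb (Φ i j)).t₁ (VinvStep Pc nb (Φ i j)).t₂ (VinvStep Pc nb (Φ i j)).U =
      lowerParity (Φ i j).t₁ (Φ i j).t₂ (lowerCap (Pc (Φ i j).pt) (Φ i j).t₁ (Φ i j).t₂ (Φ i j).U)) := by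
  refine ⟨fun i j => ?_, fun i j => ?_, fun i j => ?_, fun i j => ?_, fun i j => ?_⟩
  all_goals
    rcases h : Φ i j with ⟨x, t₁, t₂, U⟩
    obtain ⟨hx, hU, hIg, hJg, hIig, hJig, hIIg, hJIg, hIiIg, hJiIg, hJJg, hIJg, hJiJg, hIiJg, hcomm⟩ :=
      nbhd hch hsy hval hS hI hJ i j h
  · exact (VinvStep_spec hch hsy hx hU hIg hJg hIig hJig).2.2.2.2.2.1
  · exact (VinvStep_spec hch hsy hx hU hIg hJg hIig hJig).2.1
  · rw [hI, h]; exact VinvStep_Istep_comm hch hsy hx hU hIg hJg hIig hJig hIIg hJIg hIiIg hJiIg hcomm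
  · rw [hJ, h]; exact VinvStep_Jstep_comm hch hsy hx hU hIg hJg hIig hJig hJJg hIJg hJiJg hIiJg hcomm
  · exact (VinvStep_spec hch hsy hx hU hIg hJg hIig hJig).2.2.2.2.2.2.1

/-! ## Anchor -/

/-- Anchor (registered sub-goal of stmt-AtomisticToContinuum-12088, toward `develop_transport`):
the layer above a coherent valid layer `Φ : ℤ² → frames` (its `V`-images) is valid, has its sites
in `S`, is coherent, and the letter read below it is the parity of the old layer (explicit form
of `layer_up`). [folklore] -/
theorem transportGlobalA_anchor : ∀ (S : Set (EuclideanSpace ℝ (Fin 3))) (Pc : EuclideanSpace ℝ (Fin 3) → Finset (Fin 3 → ℤ)) (Ac : EuclideanSpace ℝ (Fin 3) → (EuclideanSpace ℝ (Fin 3) →ₗᵢ[ℝ] EuclideanSpace ℝ (Fin 3))) (nb : EuclideanSpace ℝ (Fin 3) → (Fin 3 → ℤ) → EuclideanSpace ℝ (Fin 3)), (∀ z ∈ S, IsZChart S z (Pc z) (Ac z) (nb z)) → (∀ x ∈ S, ∀ y ∈ shell S x, x ∈ shell S y) → ∀ (Φ : ℤ → ℤ → ZFrame), (∀ i j : ℤ,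 IsFrame (Pc (Φ i j).pt) (Φ i j).t₁ (Φ i j).t₂ (Φ i j).U) → (∀ i j : ℤ, (Φ i j).pt ∈ S) → (∀ i j : ℤ, Φ (i + 1) j = Istep Pc nb (Φ i j)) → (∀ i j : ℤ, Φ i (j + 1) = Jstep Pc nb (Φ i j)) → (∀ i j : ℤ, IsFrame (Pc (Vstep Pc nb (Φ i j)).pt) (Vstep Pc nb (Φ i j)).t₁ (Vstep Pc nb (Φ i j)).t₂ (Vstep Pc nb (Φ i j)).U) ∧ (∀ i j : ℤ, (Vstep Pc nb (Φ i j)).pt ∈ S) ∧ (∀ i j : ℤ, Vstep Pc nb (Φ (i + 1) j) = Istep Pc nb (Vstep Pc nb (Φ i j))) ∧ (∀ i j : ℤ, Vstep Pc nb (Φ i (j + 1)) = Jstep Pc nb (Vstep Pc nb (Φ i j))) ∧ (∀ i j : ℤ, lowerParity (Vstep Pc nb (Φ i j)).t₁ (Vstep Pc nb (Φ i j)).t₂ (lowerCap (Pc (Vstep Pc nb (Φ i j)).pt) (Vstep Pc nb (Φ i j)).t₁ (Vstep Pc nb (Φ i j)).t₂ (Vstep Pc nb (Φ i j)).U) = frameParity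 (Φ i j).t₁ (Φ i j).t₂ (Φ i j).U) :=
  fun _ _ _ _ hch hsy _ hval hS hI hJ => layer_up hch hsy hval hS hI hJ

end Summit.AtomisticToContinuum.Crystallization.Theorems.HullExactificationCascadeRobustBarlowTemplate

end
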